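import Summits.AtomisticToContinuum.Crystallization.Theorems.ChartedPlanarOrderTubeChannelsBox
import Summits.AtomisticToContinuum.Crystallization.Theorems.OverbindingBudgetEnergyTubeBox

/-!
# The 7c‴ box chain in lens-4's P-currency: `TubeConvexRefP (17/16) (1/40) s₁ s₂ t₁ t₂` from box-restricted leaves (decomp-a2c lens-3 g25)

`…OverbindingBudgetEnergyTubeBox.TubeConvexRefP Λ₁ ρ s₁ s₂ t₁ t₂` (lens-4 g34 part I, the cone XXX's slot 7c‴P) is the Ref binder list verbatim +
`(Pinned s₁ s₂ a b ∨ PinnedSq t₁ t₂ a b)` after `UniformlyClean` — DEFINITIONALLY `TubeConvexRefBox Λ₁ ρ (boxP s₁ s₂ t₁ t₂)` of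
`…TubeChannelsBox` (§1, `Iff.rfl`).  Hence (§2) the C182 endpoints in P-currency for any boxes, and (§3) for the CUT OF RECORD XXX_ref (square box
EMPTY, `(t₁, t₂) = (1, 0)`; critic row 509 (3)) the T-ONLY endpoints: a pinned near-equilateral cell with `s₁² > 97/150·s₂²` (e.g. the record box
`[0.966, 0.976]`) is never on the square branch `|⟪a, b⟫| ≤ 11/75·‖a‖²`, so the two S leaves hold VACUOUSLY and

  `tubeConvexRefP_of_leafCertsT_C182 : 97/150·s₂² < s₁² → 0 ≤ s₁ → AdjacentChannelRefTBox (17/16) (1/40) (boxT s₁ s₂) (17/10) (43/10) →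
     FarChannelBelowRefTBox (17/16) (1/40) (boxT s₁ s₂) muT muN 6 → TubeConvexRefP (17/16) (1/40) s₁ s₂ 1 0`

(`boxT s₁ s₂ a b w' := Pinned s₁ s₂ a b`): the M-column content of slot 7c‴P of `rdef_thirtieth_of_recordK_boxed_ref (s₁ s₂ h₀ κ′)` is EXACTLY two
literal certificate leaves on the T box — census TAG 182 R1′ (tracking cover of the T box, critic row 509 (2)).  Hessian dictionary:
`tubeConvexRefP_of_hessCertsT_C182` (two Hessian certificates on `boxT ∧ PhiT` with the C182 block literals).  §4 (courtesy; lens-4 owns the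
cone literals) threads it: RDEF cone XXXI_ref `rdef_thirtyfirst_of_recordK_boxed_leafT (s₁ s₂ h₀ κ′)` = cone XXX_ref with slot 7c‴P replaced by the
two T-box leaves (+ the instance at `[0.966, 0.976]`).
-/

noncomputable section

namespace Summit.AtomisticToContinuum.Crystallization.Theorems.ChartedPlanarOrderTubeChannelsBoxP

open scoped RealInnerProductSpace
open Summit.AtomisticToContinuum.Crystallization.Theorems.ChartedPlanarOrderRigidityDoor (E3)
open Summit.AtomisticToContinuum.Crystallization.Theorems.OverbindingBudgetRegistryCut (Pinned)
open Summit.AtomisticToContinuum.Crystallization.Theorems.OverbindingBudgetRegistrySquare (PinnedSq)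
open Summit.AtomisticToContinuum.Crystallization.Theorems.OverbindingBudgetEnergySquareExtinction (not_pinnedSq_one_zero)
open Summit.AtomisticToContinuum.Crystallization.Theorems.OverbindingBudgetEnergyTubeBox (TubeConvexRefP TubeUniquenessRefP RegistryPinningP
  rdef_thirtieth_of_recordK_boxed_ref)
open Summit.AtomisticToContinuum.Crystallization.Theses.OverbindingBudget (RobustDefectLimitWindows)
open Summit.AtomisticToContinuum.Crystallization.Theses.PricedLinkCensus (ChargedEnergyGap)
open Summit.AtomisticToContinuum.Crystallization.Theorems.ChargedEnergyGapNegative (eStar)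
open Summit.AtomisticToContinuum.Crystallization.Theorems.OverbindingBudgetGradedBareness (CleanlessExcessT)
open Summit.AtomisticToContinuum.Crystallization.Theorems.OverbindingBudgetCoherentCut (CoherentResidual)
open Summit.AtomisticToContinuum.Crystallization.Theorems.OverbindingBudgetUniformCutStatements (GrossCleanBallsU)
open Summit.AtomisticToContinuum.Crystallization.Theorems.OverbindingBudgetElasticSplitScale (CompressedVirialLaw)
open Summit.AtomisticToContinuum.Crystallization.Theorems.OverbindingBudgetScaleWidening (DoorPeriodicW)
open Summit.AtomisticToContinuum.Crystallization.Theorems.OverbindingBudgetTwoShellShape (TwoShellShape BarlowGluingW)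
open Summit.AtomisticToContinuum.Crystallization.Theorems.OverbindingBudgetStackedRigidityW (StackedReductionW GapStressVanishesW)
open Summit.AtomisticToContinuum.Crystallization.Theorems.OverbindingBudgetRegistryCut (RegistryResidual RegistryTube)
open Summit.AtomisticToContinuum.Crystallization.Theorems.OverbindingBudgetRegistryDichotomy (RegistryGeometryW BalancedLocus)
open Summit.AtomisticToContinuum.Crystallization.Theorems.OverbindingBudgetRegistryDichotomyCW (RegistryMetricCW)
open Summit.AtomisticToContinuum.Crystallization.Theorems.OverbindingBudgetEnergyStraightening (StraightenedFloor StraightCellEnergyT)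
open Summit.AtomisticToContinuum.Crystallization.Theorems.OverbindingBudgetEnergySquareExtinction (SquareCellsExtinct)
open Summit.AtomisticToContinuum.Crystallization.Theorems.ChartedPlanarOrderChannelJacobian (PhiT PhiS)
open Summit.AtomisticToContinuum.Crystallization.Theorems.ChartedPlanarOrderChannelCertC182 (muT muN muT' muN' alT alN ga alT' alN' ga')
open Summit.AtomisticToContinuum.Crystallization.Theorems.ChartedPlanarOrderTubeChannelsBox (TubeConvexRefBox TubeUniquenessRefBox
  AdjacentChannelRefTBox AdjacentChannelRefSBox FarChannelBelowRefTBox FarChannelBelowRefSBox HessCertAdjBox HessCertFarBox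
  adjacentChannelRefTBox_mono farChannelBelowRefTBox_mono hessCertAdjBox_mono hessCertFarBox_mono tubeConvexRefBox_of_leafCerts_C182
  tubeConvexRefBox_of_hessCerts_C182 adjacentChannelRefTBox_of_hess farChannelBelowRefTBox_of_hess)

/-! ## §1 The boxes and the definitional bridges -/

/-- lens-4's box predicate: pinned triangular cell OR pinned square cell. -/
def boxP (s₁ s₂ t₁ t₂ : ℝ) : E3 → E3 → (ℤ → E3) → Prop := fun a b _ => Pinned s₁ s₂ a b ∨ PinnedSq t₁ t₂ a b

/-- the T box alone (the square box of record is empty). -/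
def boxT (s₁ s₂ : ℝ) : E3 → E3 → (ℤ → E3) → Prop := fun a b _ => Pinned s₁ s₂ a b

/-- `tubeConvexRefP_iff_box` — definitional unfolding (formal bookkeeping). [folklore] -/
theorem tubeConvexRefP_iff_box {Λ₁ ρ s₁ s₂ t₁ t₂ : ℝ} : TubeConvexRefP Λ₁ ρ s₁ s₂ t₁ t₂ ↔ TubeConvexRefBox Λ₁ ρ (boxP s₁ s₂ t₁ t₂) :=
  Iff.rfl

/-- `tubeUniquenessRefP_iff_box` — definitional unfolding (formal bookkeeping). [folklore] -/
theorem tubeUniquenessRefP_iff_box {Λ₁ ρ s₁ s₂ t₁ t₂ : ℝ} :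
    TubeUniquenessRefP Λ₁ ρ s₁ s₂ t₁ t₂ ↔ TubeUniquenessRefBox Λ₁ ρ (boxP s₁ s₂ t₁ t₂) :=
  Iff.rfl

/-- with the empty square box `(1, 0)` the P box is the T box. -/
theorem boxP_one_zero_iff {s₁ s₂ : ℝ} {a b : E3} {w' : ℤ → E3} : boxP s₁ s₂ 1 0 a b w' ↔ boxT s₁ s₂ a b w' :=
  ⟨fun h => h.elim id fun hq => (not_pinnedSq_one_zero a b hq).elim, Or.inl⟩

/-! ## §2 The C182 endpoints in P-currency (both boxes symbolic) -/

/-- ★★ four box-restricted leaves with the C182 literals ⇒ `TubeConvexRefP (17/16) (1/40) s₁ s₂ t₁ t₂`. -/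
theorem tubeConvexRefP_of_leafCertsBox_C182 {s₁ s₂ t₁ t₂ : ℝ}
    (hAT : AdjacentChannelRefTBox (17 / 16) (1 / 40) (boxP s₁ s₂ t₁ t₂) (17 / 10) (43 / 10))
    (hBT : FarChannelBelowRefTBox (17 / 16) (1 / 40) (boxP s₁ s₂ t₁ t₂) muT muN 6)
    (hAS : AdjacentChannelRefSBox (17 / 16) (1 / 40) (boxP s₁ s₂ t₁ t₂) (317 / 100) (401 / 50))
    (hBS : FarChannelBelowRefSBox (17 / 16) (1 / 40) (boxP s₁ s₂ t₁ t₂) muT' muN' 6) : TubeConvexRefP (17 / 16) (1 / 40) s₁ s₂ t₁ t₂ :=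
  tubeConvexRefP_iff_box.2 (tubeConvexRefBox_of_leafCerts_C182 hAT hBT hAS hBS)

/-- ★★ four Hessian certificates on `boxP ∧ PhiT` / `boxP ∧ PhiS` with the C182 block literals ⇒ `TubeConvexRefP (17/16) (1/40) s₁ s₂ t₁ t₂`. -/
theorem tubeConvexRefP_of_hessCertsBox_C182 {s₁ s₂ t₁ t₂ : ℝ}
    (hA : HessCertAdjBox (fun a b w' => boxP s₁ s₂ t₁ t₂ a b w' ∧ PhiT a b) (24071 / 10000) (132864 / 10000) (25136 / 10000))
    (hF : HessCertFarBox (fun a b w' => boxP s₁ s₂ t₁ t₂ a b w' ∧ PhiT a b) alT alN ga 6)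
    (hA' : HessCertAdjBox (fun a b w' => boxP s₁ s₂ t₁ t₂ a b w' ∧ PhiS a b) (62184 / 10000) (146168 / 10000) (44815 / 10000))
    (hF' : HessCertFarBox (fun a b w' => boxP s₁ s₂ t₁ t₂ a b w' ∧ PhiS a b) alT' alN' ga' 6) :
    TubeConvexRefP (17 / 16) (1 / 40) s₁ s₂ t₁ t₂ :=
  tubeConvexRefP_iff_box.2 (tubeConvexRefBox_of_hessCerts_C182 hA hF hA' hF')

/-! ## §3 The cut of record: square box EMPTY — the S leaves are vacuous on a pinned near-equilateral cell -/

/-- a pinned cell with `s₁² > 97/150·s₂²` is not on the square branch. -/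
theorem not_sq_of_pinned {s₁ s₂ : ℝ} (hs : 97 / 150 * s₂ ^ 2 < s₁ ^ 2) (hs₁ : 0 ≤ s₁) {a b : E3} (hp : Pinned s₁ s₂ a b) :
    ¬ (|⟪a, b⟫| ≤ 11 / 75 * ‖a‖ ^ 2) := by
  obtain ⟨ha1, ha2, hb1, hb2, hd⟩ := hp
  intro hS
  have hSS := abs_le.1 hS
  have haa : s₁ ^ 2 ≤ ‖a‖ ^ 2 := pow_le_pow_left₀ hs₁ ha1 2
  have haa' : ‖a‖ ^ 2 ≤ s₂ ^ 2 := pow_le_pow_left₀ (norm_nonneg _) ha2 2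
  have hbb : s₁ ^ 2 ≤ ‖b‖ ^ 2 := pow_le_pow_left₀ hs₁ hb1 2
  rcases hd with ⟨-, h2⟩ | ⟨-, h2⟩
  · have h2' : ‖a - b‖ ^ 2 ≤ s₂ ^ 2 := pow_le_pow_left₀ (norm_nonneg _) h2 2
    rw [norm_sub_sq_real] at h2'
    linarith
  · have h2' : ‖a + b‖ ^ 2 ≤ s₂ ^ 2 := pow_le_pow_left₀ (norm_nonneg _) h2 2
    rw [norm_add_sq_real] at h2'
    linarith

/-- the adjacent S leaf on the P box with empty square box holds vacuously. -/
theorem adjacentChannelRefSBox_extinct {Λ₁ ρ s₁ s₂ lT lN : ℝ} (hs : 97 / 150 * s₂ ^ 2 < s₁ ^ 2) (hs₁ : 0 ≤ s₁) :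
    AdjacentChannelRefSBox Λ₁ ρ (boxP s₁ s₂ 1 0) lT lN :=
  fun _ _ a b _ _ _ _ _ _ _ _ _ hBx hS _ _ _ _ =>
    hBx.elim (fun hp => (not_sq_of_pinned hs hs₁ hp hS).elim) fun hq => (not_pinnedSq_one_zero a b hq).elim

/-- the far S leaf on the P box with empty square box holds vacuously. -/
theorem farChannelBelowRefSBox_extinct {Λ₁ ρ s₁ s₂ : ℝ} {μT μN : ℕ → ℝ} {s₀ : ℕ} (hs : 97 / 150 * s₂ ^ 2 < s₁ ^ 2) (hs₁ : 0 ≤ s₁) :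
    FarChannelBelowRefSBox Λ₁ ρ (boxP s₁ s₂ 1 0) μT μN s₀ :=
  fun _ _ a b _ _ _ _ _ _ _ _ _ hBx hS _ _ _ _ =>
    hBx.elim (fun hp => (not_sq_of_pinned hs hs₁ hp hS).elim) fun hq => (not_pinnedSq_one_zero a b hq).elim

/-- ★★★ THE ENDPOINT FOR THE CUT OF RECORD XXX_ref: TWO box-restricted T leaves on the T box `boxT s₁ s₂` (`s₁² > 97/150·s₂²`, `0 ≤ s₁`; e.g.
`[0.966, 0.976]`) with the C182 literals give lens-4's `TubeConvexRefP (17/16) (1/40) s₁ s₂ 1 0`. -/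
theorem tubeConvexRefP_of_leafCertsT_C182 {s₁ s₂ : ℝ} (hs : 97 / 150 * s₂ ^ 2 < s₁ ^ 2) (hs₁ : 0 ≤ s₁)
    (hAT : AdjacentChannelRefTBox (17 / 16) (1 / 40) (boxT s₁ s₂) (17 / 10) (43 / 10))
    (hBT : FarChannelBelowRefTBox (17 / 16) (1 / 40) (boxT s₁ s₂) muT muN 6) : TubeConvexRefP (17 / 16) (1 / 40) s₁ s₂ 1 0 :=
  tubeConvexRefP_iff_box.2
    (tubeConvexRefBox_of_leafCerts_C182 (adjacentChannelRefTBox_mono (fun _ _ _ h => boxP_one_zero_iff.1 h) hAT)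
      (farChannelBelowRefTBox_mono (fun _ _ _ h => boxP_one_zero_iff.1 h) hBT) (adjacentChannelRefSBox_extinct hs hs₁)
      (farChannelBelowRefSBox_extinct hs hs₁))

/-- ★★★ its Hessian dictionary: TWO Hessian certificates on `boxT s₁ s₂ ∧ PhiT` with the C182 T-branch block literals (adjacent
`(2.4071, 13.2864, 2.5136)`, spans `alT alN ga`; weights `θ = 7/25`, `θ_f = 1/5`) give `TubeConvexRefP (17/16) (1/40) s₁ s₂ 1 0`. -/
theorem tubeConvexRefP_of_hessCertsT_C182 {s₁ s₂ : ℝ} (hs : 97 / 150 * s₂ ^ 2 < s₁ ^ 2) (hs₁ : 0 ≤ s₁)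
    (hA : HessCertAdjBox (fun a b w' => boxT s₁ s₂ a b w' ∧ PhiT a b) (24071 / 10000) (132864 / 10000) (25136 / 10000))
    (hF : HessCertFarBox (fun a b w' => boxT s₁ s₂ a b w' ∧ PhiT a b) alT alN ga 6) : TubeConvexRefP (17 / 16) (1 / 40) s₁ s₂ 1 0 :=
  tubeConvexRefP_of_leafCertsT_C182 hs hs₁
    (adjacentChannelRefTBox_of_hess hA (θ := 7 / 25) (by norm_num) (by norm_num) (by norm_num) (by norm_num))
    (farChannelBelowRefTBox_of_hess hF (θ := fun _ => 1 / 5) (fun _ => by norm_num) (fun s => by unfold ga; split_ifs <;> norm_num)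
      (fun s => by unfold alT ga muT; split_ifs <;> norm_num) (fun s => by unfold alN ga muN; split_ifs <;> norm_num))

/-- ★★ the record T box `[0.966, 0.976]` qualifies (`97/150·0.976² = 0.616… < 0.933… = 0.966²`). -/
theorem tubeConvexRefP_record_of_leafCertsT_C182
    (hAT : AdjacentChannelRefTBox (17 / 16) (1 / 40) (boxT (966 / 1000) (976 / 1000)) (17 / 10) (43 / 10))
    (hBT : FarChannelBelowRefTBox (17 / 16) (1 / 40) (boxT (966 / 1000) (976 / 1000)) muT muN 6) :
    TubeConvexRefP (17 / 16) (1 / 40) (966 / 1000) (976 / 1000) 1 0 :=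
  tubeConvexRefP_of_leafCertsT_C182 (by norm_num) (by norm_num) hAT hBT

/-- ★★ … and in the uniqueness currency the cone consumes (`tubeUniquenessRefP_of_tubeConvexRefP`). -/
theorem tubeUniquenessRefP_of_leafCertsT_C182 {s₁ s₂ : ℝ} (hs : 97 / 150 * s₂ ^ 2 < s₁ ^ 2) (hs₁ : 0 ≤ s₁)
    (hAT : AdjacentChannelRefTBox (17 / 16) (1 / 40) (boxT s₁ s₂) (17 / 10) (43 / 10))
    (hBT : FarChannelBelowRefTBox (17 / 16) (1 / 40) (boxT s₁ s₂) muT muN 6) : TubeUniquenessRefP (17 / 16) (1 / 40) s₁ s₂ 1 0 :=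
  OverbindingBudgetEnergyTubeBox.tubeUniquenessRefP_of_tubeConvexRefP (tubeConvexRefP_of_leafCertsT_C182 hs hs₁ hAT hBT)

/-! ## §4 (courtesy, lens-4 owns the cone) RDEF cone XXXI_ref: cone XXX_ref with slot 7c‴P DISCHARGED down to the two T-box certificate leaves -/

/-- ★★★ **RDEF cone, THIRTY-FIRST form, reference-centred, T box `s₁² > 97/150·s₂²`**: `rdef_thirtieth_of_recordK_boxed_ref (s₁ s₂ h₀ κ′)` with its
slot 7c‴P `TubeConvexRefP (17/16) (1/40) s₁ s₂ 1 0` replaced by the TWO box-restricted literal certificate leaves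
`AdjacentChannelRefTBox (17/16) (1/40) (boxT s₁ s₂) (17/10) (43/10)` and `FarChannelBelowRefTBox (17/16) (1/40) (boxT s₁ s₂) muT muN 6` [CERT·M, census
TAG 182 R1′] (via `tubeConvexRefP_of_leafCertsT_C182`).  Open leaves (20 + `0 < κ′` + the two box side conditions, `norm_num` at `[0.966, 0.976]`):
slots 1–6, 7a, 7b, 7c″P, 7c‴-ADJ-T, 7c‴-FAR-T, STR, NUM-T, SQX, R3geo, `BalancedLocus`, R1, R2, R5⁺, 8, 9. -/
theorem rdef_thirtyfirst_of_recordK_boxed_leafT (s₁ s₂ h₀ κ' : ℝ) (hκ' : 0 < κ') (hs : 97 / 150 * s₂ ^ 2 < s₁ ^ 2) (hs₁ : 0 ≤ s₁)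
    (hG : GrossCleanBallsU (1 / 250) 10) (hCEG : ChargedEnergyGap) (hC : CompressedVirialLaw (1 / 250) 10)
    (hS : TwoShellShape (1 / 100) (3 / 50) (1 / 450)) (hB₂ : BarlowGluingW) (hD : DoorPeriodicW 2) (hSR : StackedReductionW 2 (17 / 16))
    (hV : GapStressVanishesW (17 / 16)) (hP : RegistryPinningP (17 / 16) (1 / 40) (3 / 16) s₁ s₂ 1 0)
    (hAT : AdjacentChannelRefTBox (17 / 16) (1 / 40) (boxT s₁ s₂) (17 / 10) (43 / 10))
    (hBT : FarChannelBelowRefTBox (17 / 16) (1 / 40) (boxT s₁ s₂) muT muN 6) (hSTR : StraightenedFloor (17 / 16))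
    (hNT : StraightCellEnergyT (17 / 16) (3 / 8) (23 / 20) s₁ s₂ (eStar + 2 * κ')) (hX : SquareCellsExtinct (17 / 16) (3 / 8) (23 / 20) (eStar + 2 * κ'))
    (hGeo : RegistryGeometryW (17 / 16) s₁ s₂ h₀ (3 / 20)) (hBal : BalancedLocus s₁ s₂ h₀ (1 / 40)) (hR1 : RegistryResidual s₁ s₂ (1 / 250))
    (hR2 : RegistryTube s₁ s₂ (1 / 100) 1) (hMet : RegistryMetricCW s₁ s₂ (3 / 500)) (hCE : CleanlessExcessT) (hRes : CoherentResidual 10) :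
    RobustDefectLimitWindows :=
  rdef_thirtieth_of_recordK_boxed_ref s₁ s₂ h₀ κ' hκ' hG hCEG hC hS hB₂ hD hSR hV hP (tubeConvexRefP_of_leafCertsT_C182 hs hs₁ hAT hBT) hSTR hNT hX
    hGeo hBal hR1 hR2 hMet hCE hRes

/-- ★★★ the same at the record T box `[0.966, 0.976]` (side conditions discharged): literals `h₀ κ′` symbolic. -/
theorem rdef_thirtyfirst_of_recordK_box966_leafT (h₀ κ' : ℝ) (hκ' : 0 < κ')
    (hG : GrossCleanBallsU (1 / 250) 10) (hCEG : ChargedEnergyGap) (hC : CompressedVirialLaw (1 / 250) 10)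
    (hS : TwoShellShape (1 / 100) (3 / 50) (1 / 450)) (hB₂ : BarlowGluingW) (hD : DoorPeriodicW 2) (hSR : StackedReductionW 2 (17 / 16))
    (hV : GapStressVanishesW (17 / 16)) (hP : RegistryPinningP (17 / 16) (1 / 40) (3 / 16) (966 / 1000) (976 / 1000) 1 0)
    (hAT : AdjacentChannelRefTBox (17 / 16) (1 / 40) (boxT (966 / 1000) (976 / 1000)) (17 / 10) (43 / 10))
    (hBT : FarChannelBelowRefTBox (17 / 16) (1 / 40) (boxT (966 / 1000) (976 / 1000)) muT muN 6) (hSTR : StraightenedFloor (17 / 16))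
    (hNT : StraightCellEnergyT (17 / 16) (3 / 8) (23 / 20) (966 / 1000) (976 / 1000) (eStar + 2 * κ'))
    (hX : SquareCellsExtinct (17 / 16) (3 / 8) (23 / 20) (eStar + 2 * κ'))
    (hGeo : RegistryGeometryW (17 / 16) (966 / 1000) (976 / 1000) h₀ (3 / 20)) (hBal : BalancedLocus (966 / 1000) (976 / 1000) h₀ (1 / 40))
    (hR1 : RegistryResidual (966 / 1000) (976 / 1000) (1 / 250)) (hR2 : RegistryTube (966 / 1000) (976 / 1000) (1 / 100) 1)
    (hMet : RegistryMetricCW (966 / 1000) (976 / 1000) (3 / 500)) (hCE : CleanlessExcessT) (hRes : CoherentResidual 10) :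
    RobustDefectLimitWindows :=
  rdef_thirtyfirst_of_recordK_boxed_leafT (966 / 1000) (976 / 1000) h₀ κ' hκ' (by norm_num) (by norm_num) hG hCEG hC hS hB₂ hD hSR hV hP hAT hBT
    hSTR hNT hX hGeo hBal hR1 hR2 hMet hCE hRes

end Summit.AtomisticToContinuum.Crystallization.Theorems.ChartedPlanarOrderTubeChannelsBoxP

end
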